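import Summits.AnomalousDissipation.AnomalousDissipation.Theses.TaylorCertificates
import Summits.AnomalousDissipation.AnomalousDissipation.Theorems.KolmogorovFloorEnsembleCeiling.Negative.PlanarSteady

/-!
# Route TaylorCertificates — the support `SteadyClassicalBridge`

Proof of the route declaration
`Summit.AnomalousDissipation.AnomalousDissipation.Theses.TaylorCertificates.SteadyClassicalBridge`
(item stmt-AnomalousDissipation-14884): from the `H`-weak to the classical steady formulation.

If `u ∈ H` is a steady weak solution of `NS_ν(f)` in the sense of
`Literature.Analysis.FluidPDE.Torus.IsSteadyWeakSolution` (`(f,w) + ν(u,Δw) + ∫⟪Dw·u, u⟫ = 0` for every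
smooth divergence-free mean-zero `w`), `f` is smooth, and `v` is a smooth a.e.-representative of `u`, then

* `v` is divergence free and mean zero (weak solenoidality and the zero mean of `H` transported along
  the a.e.-equality, then upgraded on the smooth representative), and
* `∫⟪νΔv − (v·∇)v + f, w⟫ = 0` for every smooth divergence-free mean-zero `w` (Green's second identity
  and the antisymmetry of the trilinear form move all derivatives back onto `v`).

Both steps are the landed generic torus lemmas `divFree_meanZero_of_rep` and
`residual_orthogonal_of_steadyWeak` of
`Summits/AnomalousDissipation/AnomalousDissipation/Theorems/KolmogorovFloorEnsembleCeiling/Negative/PlanarSteady.lean`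
(whose `steadyResidual ν f v x = ν • Δv x − (v·∇)v x + f x` unfolds by `rfl`), specialised to `d = Fin 3`.
Sources of the route step: Temam 1979 (steady weak solutions), Foias–Manley–Rosa–Temam 2001.
-/

namespace Summit.AnomalousDissipation.AnomalousDissipation.Theorems

-- the mandated namespace `Summit.<Summit>.<Problem>.Theorems` repeats `AnomalousDissipation` (single-problem summit)
set_option linter.dupNamespace false

open Summit.AnomalousDissipation.AnomalousDissipation.Theses.TaylorCertificates
open Summit.AnomalousDissipation.AnomalousDissipation.Theorems.KolmogorovFloorEnsembleCeiling.Negative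

/-- **From the `H`-weak to the classical steady formulation** (item stmt-AnomalousDissipation-14884).
For every viscosity `ν`, smooth force `f`, state `u ∈ H` which is an `H`-steady weak solution of
`NS_ν(f)`, and smooth `v` with `u = v` a.e.: `v` is divergence free, mean zero, and
`∫⟪ν • Δv − (v·∇)v + f, w⟫ = 0` for every smooth divergence-free mean-zero test field `w`.
Proof: `divFree_meanZero_of_rep` and `residual_orthogonal_of_steadyWeak` (landed, any dimension) at
`d = Fin 3`; the residual integrand is `steadyResidual ν f v` definitionally. -/
theorem steadyClassicalBridge_proof :
    Summit.AnomalousDissipation.AnomalousDissipation.Theses.TaylorCertificates.SteadyClassicalBridge := by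
  unfold SteadyClassicalBridge
  intro ν f v u hf hsteady hv hu
  obtain ⟨hvd, hvz⟩ := divFree_meanZero_of_rep hv hu
  exact ⟨hvd, hvz, residual_orthogonal_of_steadyWeak hf hsteady hv hu⟩

end Summit.AnomalousDissipation.AnomalousDissipation.Theorems
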